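import Summits.ResolutionOfSingularities.ResolutionOfSingularities.Theorems.PurelyInseparableDim4ResConeCornerTransport
import Summits.ResolutionOfSingularities.ResolutionOfSingularities.Theorems.PurelyInseparableDim4ResConePolarFree
import Summits.ResolutionOfSingularities.ResolutionOfSingularities.Theorems.PurelyInseparableDim4IsolatedPoint
import HarnessLib
import HarnessLib.Audit.Tags

/-!
# Purely inseparable four-folds — the TWO WALLS of the isolation window in a pure-corner coordinate frame:
# the cone free of the active letters gives `σ > 1`, isolation of the child gives a monomial with `σ < 2`
# (idea-4 CARD I-4-8 §B, kernel form; K2(p) lane, SLICE C (C5), file-holder res-dim4-p-5 g3)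

[OURS · counted 0 · cell `res-dim4-pi` · K2(p) lane (desk WORDS #78 (d), #80 (d)) · seat res-dim4-p-5 g3.]
Nothing here proves K2(p), `NoIsolatedTrap p p` or resolution of singularities in dimension ≥ 4 /
characteristic `p`.

Setting (`…ResConeCornerTransport`): state `s = (F, r, exc)`, `x^r ∣ F`, `ord₀ F = o`, `d = o − |r|`; two ACTIVE
letters `a ≠ a′` and the passive set `P = univ ∖ {a, a′}`; a monomial `x^e` of `F` with residual exponent
`f = e − r` and PASSIVE DEGREE `|f|_P < d` is a generating point `(f_a, f_{a′}) / n` of Hironaka's polygon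
`Δ(G; x_a, x_{a′}; x_P)`, of LEVEL `n = d − |f|_P`, `σ = (f_a + f_{a′}) / n`.

* §1 **LOWER WALL** `apply_add_apply_gt_level_of_free`: if the residual cone `resForm s` involves neither `x_a`
  nor `x_{a′}` (for `d < p`: `e_a, e_{a′} ∈ resVertex s`, `…PolarFree`), every generating point has `σ > 1`:
  `n < f_a + f_{a′}` (the monomials of residual degree exactly `d` are the cone's and have level `0`);
* §2 **UPPER WALL** `exists_apply_add_apply_lt_two_mul_level`: at a PURE CORNER in chart `a` whose child
  `s′ = step p univ a 0 s` is an ISOLATED `p`-fold point, if the two active letters are LIGHT —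
  `r_a + r_{a′} ≤ 2 (o − p)` (= twice the multiplicity of the new component) — some monomial of `F` that survives
  in `F′` is a generating point with `σ < 2`: `f_a + f_{a′} < 2n`.  Mechanism: isolation forbids the line
  `C′ = P(⟨e_a, e_{a′}⟩) ∩ E_new = V(x_i : i ≠ a′)` to be `p`-fold (`…IsolatedPoint`), i.e.
  `ordAlong (univ.erase a′) F′ < p`, and (`degIn_erase_chartExponent`) the `(univ ∖ a′)`-degree of the chart
  image of `x^{r + f}` is `(o − p) + |r| − r_a − r_{a′} + f_a + f_{a′} + 2|f|_P − d`, i.e. `w(C′) + n(σ − 2) + d`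
  ([CJS 2020] Lemma 12.3: «near ⟺ δ ≥ 2», here fed by `p`-fold isolation of the ambient point).
[cite: CossartJannsenSaito2020, Lemma 12.3, Lemma 13.2]
bears_on: LADDER-RESOLUTION:D157-DOOR2 (res-dim4-pi · K2(p) = `RidgeBudget.NoAboveFloorTrap p p` · slice C).
Supports stmt-ResolutionOfSingularities-16155 (helper).
-/

set_option linter.dupNamespace false -- mandated namespace of this single-conjunct summit

noncomputable section

namespace Summit.ResolutionOfSingularities.ResolutionOfSingularities.Theorems.PIDim4

namespace ResCone

open MvPolynomial Finset
open Literature.AlgebraicGeometry.Resolution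
open Literature.AlgebraicGeometry.Resolution.CentreBlowup
open Literature.AlgebraicGeometry.Resolution.Hauser2010
open Literature.AlgebraicGeometry.Resolution.HauserPerlega2019

variable {K : Type} [Field K]

/-! ## 1. Lower wall: the cone is free of the active letters -/

/-- A monomial of `F` of degree exactly `ord₀ F` is a monomial of the residual cone (shifted by `r`). [folklore] -/
theorem sub_mem_support_resForm {s : State K} {o : ℕ} (ho : ordZero s.F = o)
    (hr : ∀ d ∈ s.F.support, s.r ≤ d) {e : Fin 4 →₀ ℕ} (he : e ∈ s.F.support) (hdeg : e.degree = o) :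
    e - s.r ∈ (resForm s).support := by
  rw [MvPolynomial.mem_support_iff, coeff_resForm, add_tsub_cancel_of_le (hr e he),
    NarrowApolarity.coeff_initialForm_of_degree_eq ho hdeg]
  exact MvPolynomial.mem_support_iff.mp he

/-- Residual exponents have degree `≥ d = o − |r|`, with equality exactly in degree `o`. [folklore] -/
theorem le_degree_sub {s : State K} {o : ℕ} (ho : ordZero s.F = o) (hr : ∀ d ∈ s.F.support, s.r ≤ d)
    {e : Fin 4 →₀ ℕ} (he : e ∈ s.F.support) : o - s.r.degree ≤ (e - s.r).degree := by
  have h1 := degree_sub_add_degree (hr e he)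
  have h2 := le_degree_of_mem_support_of_ordZero ho he
  omega

/-- **LOWER WALL (`σ > 1`)**: if the residual cone involves neither active letter, every monomial of `F` of
positive level (`|f|_P < d`) has `n = d − |f|_P < f_a + f_{a′}`. [cite: CossartJannsenSaito2020, Lemma 13.2] -/
theorem apply_add_apply_gt_level_of_free {s : State K} {o : ℕ} (ho : ordZero s.F = o)
    (hr : ∀ d ∈ s.F.support, s.r ≤ d) {a a' : Fin 4} (h : a ≠ a')
    (hfree : ∀ μ ∈ (resForm s).support, μ a = 0 ∧ μ a' = 0) {e : Fin 4 →₀ ℕ} (he : e ∈ s.F.support)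
    (hlev : degIn ((Finset.univ.erase a).erase a') (e - s.r) < o - s.r.degree) :
    (o - s.r.degree) - degIn ((Finset.univ.erase a).erase a') (e - s.r) < (e - s.r) a + (e - s.r) a' := by
  have hsplit := degree_eq_apply_add_apply_add_degIn h (e - s.r)
  have hd := le_degree_sub ho hr he
  rcases hd.lt_or_eq with hlt | heq
  · omega
  · -- residual degree exactly `d`: a monomial of the cone, hence free of `a, a′` — level `0`, excluded
    exfalso
    have hdeg : e.degree = o := by
      have h1 := degree_sub_add_degree (hr e he)
      have h2 := degree_r_le ho hr
      omega
    obtain ⟨ha, ha'⟩ := hfree _ (sub_mem_support_resForm ho hr he hdeg)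
    rw [ha, ha', zero_add, zero_add] at hsplit
    omega

/-- The freeness hypothesis from the polar kernel, tame case: `e_a, e_{a′} ∈ resVertex s` with `d < p`.
[cite: CossartJannsenSaito2020, Def. 2.8] -/
theorem free_of_single_mem_resVertex (p : ℕ) [Fact p.Prime] [CharP K p] {s : State K} {o : ℕ}
    (ho : ordZero s.F = o) (hdp : o - s.r.degree < p) {a a' : Fin 4}
    (ha : (Pi.single a 1 : Fin 4 → K) ∈ resVertex s) (ha' : (Pi.single a' 1 : Fin 4 → K) ∈ resVertex s) :
    ∀ μ ∈ (resForm s).support, μ a = 0 ∧ μ a' = 0 := fun μ hμ =>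
  ⟨(single_mem_resVertex_iff_free p ho hdp a).mp ha μ hμ, (single_mem_resVertex_iff_free p ho hdp a').mp ha' μ hμ⟩

/-! ## 2. Upper wall: the child is an isolated `p`-fold point -/

/-- `Σ_{i ≠ a′} g_i = |g| − g_{a′}`. [folklore] -/
theorem degIn_erase_add_apply (a' : Fin 4) (g : Fin 4 →₀ ℕ) :
    degIn (Finset.univ.erase a') g + g a' = g.degree := by
  rw [← degIn_univ, degIn, degIn, Finset.sum_erase_add _ _ (Finset.mem_univ a')]

/-- **The `(univ ∖ a′)`-degree of a chart image** (pure corner in chart `a ≠ a′`):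
`Σ_{i ≠ a′} e′_i + r_a + r_{a′} + q + d + f_a + f_{a′} = |r| + o + 2|f|` for `e = r + f ∈ supp F` — i.e.
`Σ_{i ≠ a′} e′_i = w(C′) + n(σ − 2) + d` with `w(C′) = (o − q) + |r|_P`. [cite: CossartJannsenSaito2020, Lemma 12.3] -/
theorem degIn_erase_chartExponent [DecidableEq K] (q : ℕ) {a a' : Fin 4} (h : a ≠ a') (s : State K)
    {o : ℕ} (ho : ordZero s.F = o) (hr : ∀ d ∈ s.F.support, s.r ≤ d) (hqo : q ≤ o) {e : Fin 4 →₀ ℕ}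
    (he : e ∈ s.F.support) :
    degIn (Finset.univ.erase a') (chartExponent q Finset.univ a e) + s.r a + s.r a' + q + (o - s.r.degree) +
        (e - s.r) a + (e - s.r) a' = s.r.degree + o + 2 * (e - s.r).degree := by
  have hre : s.r ≤ e := hr e he
  have h1 := degIn_erase_add_apply a' (chartExponent q Finset.univ a e)
  have h2 := degree_chartExponent_univ q a (e := e)
    ((le_degree_of_mem_support_of_ordZero ho he).trans' hqo)
  have h3 : chartExponent q Finset.univ a e a' = e a' := chartExponent_apply_of_ne q Finset.univ h.symm e
  have h4 := degree_sub_add_degree hre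
  have h5 := le_degree_of_mem_support_of_ordZero ho he
  have h6 := degree_r_le ho hr
  have h7 : (e - s.r) a' + s.r a' = e a' := by rw [Finsupp.tsub_apply, tsub_add_cancel_of_le (hre a')]
  have h8 : (e - s.r) a + s.r a = e a := by rw [Finsupp.tsub_apply, tsub_add_cancel_of_le (hre a)]
  have h9 : s.r a + s.r a' ≤ s.r.degree := by
    have := degree_eq_apply_add_apply_add_degIn h s.r
    omega
  have h10 : e a + e a' ≤ e.degree := by
    have := degree_eq_apply_add_apply_add_degIn h e
    omega
  omega

/-- Isolation of a `p`-fold point forbids every coordinate AXIS to be `p`-fold: `ordAlong (univ.erase i) F < p`.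
[cite: HauserPerlega2019PRIMS, §2 (permissible blowups)] -/
theorem ordAlong_erase_lt_of_isIsolated {p : ℕ} {F : MvPolynomial (Fin 4) K} (hiso : IsIsolated p F)
    (i : Fin 4) : ordAlong (Finset.univ.erase i) F < p := by
  by_contra h
  exact IsolationCert.not_isIsolated_of_le_ordAlong_of_ne_univ (not_lt.mp h)
    (fun heq => absurd (heq ▸ Finset.mem_univ i) (Finset.notMem_erase i _)) hiso

/-- A polynomial with `ordAlong S F < p` has a monomial of `S`-degree `< p`. [folklore] -/
theorem exists_degIn_lt_of_ordAlong_lt {S : Finset (Fin 4)} {F : MvPolynomial (Fin 4) K} {p : ℕ}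
    (h : ordAlong S F < p) : ∃ e ∈ F.support, degIn S e < p := by
  unfold ordAlong at h
  obtain ⟨e, he, hlt⟩ := Finset.inf_lt_iff.mp h
  exact ⟨e, he, by exact_mod_cast hlt⟩

/-- **UPPER WALL (`σ < 2` somewhere)**: at a pure corner in chart `a` (`x^r ∣ F`, `p ≤ ord₀ F = o`) whose child
`step p univ a 0 s` is an ISOLATED `p`-fold point, with LIGHT active letters `r_a + r_{a′} ≤ 2 (o − p)`, some
monomial `x^e` of `F` surviving in the child has positive level and `σ < 2`:
`f_a + f_{a′} + 2 |f|_P < 2d` (`f = e − r`, `d = o − |r|`). [cite: CossartJannsenSaito2020, Lemma 12.3] -/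
theorem exists_apply_add_apply_lt_two_mul_level [DecidableEq K] (p : ℕ) {a a' : Fin 4} (h : a ≠ a')
    (s : State K) {o : ℕ} (ho : ordZero s.F = o) (hr : ∀ d ∈ s.F.support, s.r ≤ d) (hpo : p ≤ o)
    (hiso : IsIsolated p (CentreBlowup.step p Finset.univ a 0 s).F)
    (hlight : s.r a + s.r a' + 2 * p ≤ 2 * o) :
    ∃ e ∈ s.F.support, chartExponent p Finset.univ a e ∈ (CentreBlowup.step p Finset.univ a 0 s).F.support ∧
      (e - s.r) a + (e - s.r) a' + 2 * degIn ((Finset.univ.erase a).erase a') (e - s.r) <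
        2 * (o - s.r.degree) := by
  obtain ⟨E, hE, hElt⟩ := exists_degIn_lt_of_ordAlong_lt (ordAlong_erase_lt_of_isIsolated hiso a')
  obtain ⟨e, he, heE⟩ := exists_of_mem_support_step_zero a s hE
  refine ⟨e, he, heE ▸ hE, ?_⟩
  rw [← heE] at hElt
  have hid := degIn_erase_chartExponent p h s ho hr hpo he
  have hsplit := degree_eq_apply_add_apply_add_degIn h (e - s.r)
  have hro := degree_r_le ho hr
  omega

end ResCone

end Summit.ResolutionOfSingularities.ResolutionOfSingularities.Theorems.PIDim4

end
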